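import Summits.QuantumFields.YangMills.Theorems.BalabanUVNodesN08AlphaEq324RowCore
import Summits.QuantumFields.YangMills.Theorems.BalabanUVNodesN08AlphaZeroDataRows

/-!
# Route «BalabanUVNodes», Track-A DAG node N08 = [Balaban1985UV3] Thm 1 p. 257 ∕ Thm 2 p. 272 — THE CORE (α) CLAUSE AT ZERO EXPANSION DATA:
# `StepAlphaEq324Core` ∕ `RunAlphaEq324Core` for the zero series hold IFF the residual pair + the external-input rows hold — with NO sign condition on
# the (3.24) constants beyond the record's `0 ≤ Ca + Cc` (the tilted schema needed `0 ≤ Ca` and `0 ≤ Cc` separately: dag-n08-d's located mismatch #1)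

Cell `pub-ymgap`, seat `pub-ymgap-dag-n08-w4` gen 0 (INTENT-3; sequel of `…N08AlphaEq324RowCore` and of dag-n08-d's zero-data reading
`…N08AlphaZeroDataRows`).  `bears_on: R4∕N08`; filed `--supports stmt-QuantumFields-20542` (K1⁷).  THEOREMS ONLY (def-free, sorry-free, standard axioms).

WHAT THIS FILE PROVES (all at dag-n08-d's zero series `zeroRun 𝔊 𝔠`, zero auxiliary data `zeroAlpha 𝔊 𝔠 X hfar`, ANY external inputs `X`; hypotheses:
`hfar` (G3D-06's right side nonnegative — automatic on the run) and the family condition `g_k ≤ 1` ∕ `g²ε₀ ≤ 1`; NO hypothesis on the signs of `Ca`, `Cc`):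
* ★ `stepAlphaEq324Core_zero_iff` — the 22-row CORE step list holds at zero data IFF its residual pair R3D-01∕R3D-02 holds AND «`U_k(·,h)` measurable»:
  the seventeen other rows (G3D-01∕02∕04∕05∕06, (26), (28), the PRINTED (3.24) row — `∫_{univ} e^{0} d(δ) = 1 = exp(Σ 0 + 0)`, `|0| ≤ (Ca+Cc)·rem` by
  the record's `Cac_nonneg` —, the identifications `hPY`∕`hPYZ`∕`hact`, (44) + floor, `Pint` measurable and `≤ 0`) are satisfied by zero data;
  the proof re-uses dag-n08-d's per-row zero-data facts (`zeroNorm35Model`, `zeroLogZTModel`, `zeroGraphTerms_act`, `jet26_apply_zero`,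
  `zeroSeries_cum`, `inputOf_zeroRun_Pint`, `stepRowsI_zero_iff`).
* ★ `runAlphaEq324Core_zero_iff` — the CORE run clause at zero data ⟺ (∀ k < K, residual pair) ∧ `RunRowsI 𝔊 𝔠 X (zeroRun 𝔊 𝔠)` (the class-I rows, which
  at zero data read the external inputs only).
* `ca_nonneg_of_stepDataRows_zero` — CONTRAST, kernel-checked: the lane's∕gen 0's tilted schema `StepDataRows` at zero data FORCES `0 ≤ Ca` (row (3.24)(a)
  at `log μ(univ) = 0`), so for a record with `Ca < 0 ≤ Ca + Cc` the tilted (α) clause is UNINHABITABLE at zero data while the core clause is inhabited there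
  (given the residual pair) — dag-n08-d's located «(α)-schema mismatch #1» (`HOME/pub-ymgap-dag-n08-d/N08-ALPHA-LOCATED-g6∕g7.md`) is RESOLVED by the
  source-faithful reading: the printed (3.24) sentence only ever needs `Ca + Cc ≥ 0`, which the record carries (`AlphaConsts.Cac_nonneg`).
READING (census-level, for dag-lead ∕ the referees' A6): the edited clause's A6 status is EXACTLY the lane's — inhabited at zero data modulo the residual pair
and the external-input rows — and strictly better on the constants' signs.  HONEST FRAMING: count-neutral kernel statements about the TYPING of the lane's (α)
clause; the zero series is test data, not Bałaban's expansion; nothing of [B10] asserted; N08 NOT discharged; d = 3 lattice gauge theory on finite tori inside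
the record; nothing about d = 4, the continuum, OS axioms, a mass gap or Clay — R4 closes the conditional finite-𝕋⁴ rung `BalabanLadder.UV` only.
-/

noncomputable section

namespace Summit.QuantumFields.YangMills.Theorems.BalabanUVNodesN08AlphaEq324RowCoreZero

open MeasureTheory ProbabilityTheory Metric
open scoped BigOperators Matrix
open Literature.MathematicalPhysics.QuantumFieldTheory.Balaban1983to89
open Literature.MathematicalPhysics.QuantumFieldTheory.Balaban1983to89.B10
open Literature.MathematicalPhysics.QuantumFieldTheory.Balaban1983to89.B10SectCExpansion (Shape43 Bound44 TermSizes)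
open Literature.MathematicalPhysics.QuantumFieldTheory.Balaban1983to89.B10Eq24Cumulant (chiMeasure truncExp)
open Literature.MathematicalPhysics.QuantumFieldTheory.Balaban1983to89.TreeLengthTorus (tsys)
open Literature.MathematicalPhysics.QuantumFieldTheory.Balaban1983to89.B1Sect3Statements (Eq324)
open Literature.MathematicalPhysics.QuantumFieldTheory.Balaban1985CMP102
open Literature.MathematicalPhysics.QuantumFieldTheory.Balaban1985CMP102.Setting
open Literature.MathematicalPhysics.QuantumFieldTheory.Balaban1985CMP102.Binders
open Literature.MathematicalPhysics.QuantumFieldTheory.Balaban1985CMP102.BindersNewborn (NewbornTerms45AsCited)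
open Summit.QuantumFields.Balaban3D.Carriers
open Summit.QuantumFields.Balaban3D.Proofs.Inputs
open Summit.QuantumFields.Balaban3D.Proofs.Primitives (AlphaConsts)
open Summit.QuantumFields.Balaban3D.Proofs.GroupModelLieC (lieC)
open Summit.QuantumFields.Balaban3D.Proofs.UVStability3DInputs
open Summit.QuantumFields.Balaban3D.Proofs.Representation33 (jet26 jet26_apply_zero)
open Summit.QuantumFields.Balaban3D.Proofs.Bound55Std (Fibre49 Fibre57Low)
open Summit.QuantumFields.Balaban3D.Proofs.ScalesArithmetic (gk_pos gk_le_one sites_nonneg sites_pos g0sq_pos L_pos)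
open Summit.QuantumFields.Balaban3D.Proofs.VacuumAndBooking (rFun_nonneg)
open Summit.QuantumFields.YangMills.Theorems.BalabanUVNodesN08AlphaClassI
open Summit.QuantumFields.YangMills.Theorems.BalabanUVNodesN08AlphaZeroData
open Summit.QuantumFields.YangMills.Theorems.BalabanUVNodesN08AlphaZeroDataRows
open Summit.QuantumFields.YangMills.Theorems.BalabanUVNodesN08AlphaEq324RowCore

variable {L : ℕ}

section Step

variable {S : Scales L} {G : Type} [GaugeGroup G] [MeasurableSpace G] [HaarData G] (𝔊 : GroupModel G) (𝔠 : AlphaConsts L 𝔊.N)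
  (X : ExternalInputs S G)

open Classical in
/-- ★ **THE CORE STEP LIST AT ZERO EXPANSION DATA IS «RESIDUAL PAIR ∧ MEASURABLE MINIMISERS»** — with NO sign hypothesis on `Ca`, `Cc`.  For the zero step
series with the zero auxiliary data and ANY external inputs `X`, on the family `g_k ≤ 1`: `StepAlphaEq324Core k` HOLDS IFF R3D-01 `fibre49` (every new
history), R3D-02 `fibre57Low` and «`U_k(·,h)` measurable» hold — the seventeen other rows, INCLUDING THE PRINTED (3.24) ROW (`lhs = 1`, cumulants `0`,
remainder `0`, `|0| ≤ (Ca+Cc)·(Lᵏg₀²)^{3+κ₀}|T₁^{(k)}|` by `Cac_nonneg`), are satisfied by zero data. [cite: Balaban1985UV3, (41) p.266 + (55)–(63) pp.269–272; Balaban1982Higgs1, (3.24) p.616] -/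
theorem stepAlphaEq324Core_zero_iff
    (hfar : ∀ k, 0 ≤ 𝔠.Cfar * (𝔠.C63 * (S.gk k ^ 7 * (rFun 𝔠.r₀ (S.gk k) * pFun 𝔠.b₀ 𝔠.p₀ (S.gk k)) ^ 7))) {k : ℕ} (hg1 : S.gk k ≤ 1) :
    StepAlphaEq324Core 𝔊 𝔠 X (zeroRun 𝔊 𝔠) (zeroAlpha 𝔊 𝔠 X hfar) k ↔
      ((∀ h' : Hist S.P (k + 1),
          Fibre49 X 𝔠.lane.carrier (zeroRun 𝔊 𝔠) (fun _ => True) k (piecesW 𝔠.lane X (zeroRun 𝔊 𝔠) k) h') ∧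
        Fibre57Low X 𝔠.lane.carrier (zeroRun 𝔊 𝔠) (fun _ => True) k (piecesW 𝔠.lane X (zeroRun 𝔊 𝔠) k)) ∧
      ∀ h : Hist S.P k, Measurable (X.UkH k h) := by
  refine ⟨fun A => ⟨⟨A.fibre49, A.fibre57Low⟩, A.hU⟩, fun H => ?_⟩
  have hg : 0 < S.gk k := gk_pos S k
  have hrp := rFun_mul_pFun_nonneg 𝔠 hg1
  have hI := (stepRowsI_zero_iff 𝔊 𝔠 X hg1).2 H.2
  have hrem : 0 ≤ (𝔠.Ca + 𝔠.Cc) * ((L : ℝ) ^ k * S.g0sq) ^ (3 + 𝔠.κ₀) * S.sites k :=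
    mul_nonneg (mul_nonneg 𝔠.Cac_nonneg (Real.rpow_nonneg (mul_nonneg (pow_nonneg (Nat.cast_nonneg _) _)
      (g0sq_pos S).le) _)) (sites_nonneg S k)
  exact
    { chart := fun Y => ⟨𝔠.ρ_pos, differentiableOn_const _, fun z _ => by
        show ‖(0 : ℂ)‖ ≤ _
        rw [norm_zero]
        exact mul_nonneg (mul_nonneg 𝔠.C25_nonneg hg.le) (Real.exp_pos _).le⟩
      bound28 := fun Y h U => by
        show ‖(0 : PBond S.P k → ↥(lieC 𝔊))‖ ≤ _
        rw [norm_zero]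
        exact mul_nonneg 𝔠.cB_nonneg (mul_nonneg (mul_nonneg (rFun_nonneg 𝔠.r₀ _ hg hg1) hg.le)
          (pFun_nonneg 𝔠.b₀ 𝔠.p₀ (S.gk k) 𝔠.b₀_pos.le hg hg1))
      inv26 := fun _ _ _ _ _ => rfl
      far_le := fun Y h U => by
        show |(0 : ℝ)| ≤ _
        rw [abs_zero]
        exact mul_nonneg 𝔠.Cfar_nonneg (mul_nonneg (mul_nonneg (mul_nonneg 𝔠.C25_nonneg hg.le) (Real.exp_pos _).le)
          (mul_nonneg (pow_nonneg hg.le _) (pow_nonneg hrp _)))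
      hPY := fun h U => by simp [jet26_apply_zero]
      hPYZ := fun h U => by simp [jet26_apply_zero]
      norm35 := fun h => ⟨zeroNorm35Model 𝔊 𝔠 X k h⟩
      logZT := ⟨zeroLogZTModel 𝔊 𝔠 X k⟩
      hact := fun h Y U => by
        rw [zeroSeries_act]
        exact zeroGraphTerms_act Y U
      hG := fun h =>
        ⟨fun U => by simp, fun γ hγ => by simp at hγ, fun γ hγ => by simp at hγ, fun γ hγ => by simp at hγ⟩
      h324 := fun h U => by
        refine ⟨0, by rw [abs_zero]; exact hrem, ?_⟩
        show ∫ _ω in (Set.univ : Set Unit), Real.exp 0 ∂(Measure.dirac ()) = _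
        simp
      h44 := hI.h44
      hfloor := hI.hfloor
      hU := H.2
      hPm := fun h => by
        have : (inputOf 𝔠.lane X (zeroRun 𝔊 𝔠)).Pint k h = fun _ => 0 := funext (inputOf_zeroRun_Pint 𝔊 𝔠 X k h)
        rw [this]
        exact measurable_const
      hPb := fun h U => by
        rw [inputOf_zeroRun_Pint]
        exact le_rfl
      fibre49 := H.1.1
      fibre57Low := H.1.2 }

/-- ★ **THE CORE RUN CLAUSE AT ZERO EXPANSION DATA = RESIDUAL PAIRS + THE EXTERNAL-INPUT ROWS** (no sign hypothesis on `Ca`, `Cc`): on a family member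
(`g²ε₀ ≤ 1`), `RunAlphaEq324Core` for the zero series and zero auxiliary data HOLDS IFF (i) for every step `k < K` the residual rows R3D-01∕R3D-02 hold and
(ii) the class-I run rows `RunRowsI` hold (at zero data: «`U_k(·,h)` measurable», (67) ∘ large field, (68) — the external inputs `X` only).
[cite: Balaban1985UV3, (41) p.266 + (47) p.267 + (67)–(68) p.273] -/
theorem runAlphaEq324Core_zero_iff
    (hfar : ∀ k, 0 ≤ 𝔠.Cfar * (𝔠.C63 * (S.gk k ^ 7 * (rFun 𝔠.r₀ (S.gk k) * pFun 𝔠.b₀ 𝔠.p₀ (S.gk k)) ^ 7)))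
    (hle : S.g ^ 2 * S.ε₀ ≤ 1) :
    RunAlphaEq324Core 𝔊 𝔠 X (zeroRun 𝔊 𝔠) (zeroAlpha 𝔊 𝔠 X hfar) ↔
      (∀ k, k + 1 ≤ S.K →
        (∀ h' : Hist S.P (k + 1),
            Fibre49 X 𝔠.lane.carrier (zeroRun 𝔊 𝔠) (fun _ => True) k (piecesW 𝔠.lane X (zeroRun 𝔊 𝔠) k) h') ∧
          Fibre57Low X 𝔠.lane.carrier (zeroRun 𝔊 𝔠) (fun _ => True) k (piecesW 𝔠.lane X (zeroRun 𝔊 𝔠) k)) ∧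
      RunRowsI 𝔊 𝔠 X (zeroRun 𝔊 𝔠) := by
  constructor
  · intro R
    refine ⟨fun k hk => ((stepAlphaEq324Core_zero_iff 𝔊 𝔠 X hfar (gk_le_one S hle k (by omega))).1 (R.steps k hk)).1,
      ⟨fun k hk => ?_, R.hLF67, R.h68⟩⟩
    exact (stepRowsI_zero_iff 𝔊 𝔠 X (gk_le_one S hle k (by omega))).2
      ((stepAlphaEq324Core_zero_iff 𝔊 𝔠 X hfar (gk_le_one S hle k (by omega))).1 (R.steps k hk)).2
  · rintro ⟨H, I⟩
    exact ⟨fun k hk => (stepAlphaEq324Core_zero_iff 𝔊 𝔠 X hfar (gk_le_one S hle k (by omega))).2 ⟨H k hk, (I.steps k hk).hU⟩,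
      I.hLF67, I.h68⟩

/-- **CONTRAST — THE TILTED SCHEMA AT ZERO DATA FORCES `0 ≤ Ca`** (dag-n08-d's located «(α)-schema mismatch #1», kernel form): if gen 0's DATA schema
`StepDataRows k` (= the (α) step list's data rows in the TILTED (3.24) currency) holds for the zero series at some auxiliary data, then `0 ≤ 𝔠.Ca` — its row
(3.24)(a) reads `|log δ(univ)| = 0 ≤ Ca·(Lᵏg₀²)^{3+κ₀}|T₁^{(k)}|` with a POSITIVE unit.  So a record with `Ca < 0 ≤ Ca + Cc` makes the tilted clause
UNINHABITABLE at zero data, while the core clause is inhabited there given the residual pair (`stepAlphaEq324Core_zero_iff`): the printed (3.24) sentence only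
needs `Ca + Cc ≥ 0`. [cite: Balaban1982Higgs1, (3.24) p.616; Balaban1985UV3, (58) p.270] -/
theorem ca_nonneg_of_stepDataRows_zero {𝔄 : AlphaData 𝔊 𝔠 X (zeroRun 𝔊 𝔠)} {k : ℕ}
    (D : StepDataRows 𝔊 𝔠 X (zeroRun 𝔊 𝔠) 𝔄 k) : 0 ≤ 𝔠.Ca := by
  have h := D.h324a (Hist.triv S.P (k + 1)) (fun _ => 1)
  have h0 : |Real.log (((zeroRun 𝔊 𝔠 k).μ).real ((zeroRun 𝔊 𝔠 k).box (Hist.triv S.P (k + 1))))| = 0 := by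
    show |Real.log ((Measure.dirac () : Measure Unit).real Set.univ)| = 0
    rw [probReal_univ, Real.log_one, abs_zero]
  rw [h0] at h
  have hunit : 0 < ((L : ℝ) ^ k * S.g0sq) ^ (3 + 𝔠.κ₀) * S.sites k :=
    mul_pos (Real.rpow_pos_of_pos (mul_pos (pow_pos (L_pos S) _) (g0sq_pos S)) _) (sites_pos S k)
  rw [mul_assoc] at h
  exact (mul_nonneg_iff_of_pos_right hunit).mp h

end Step

end Summit.QuantumFields.YangMills.Theorems.BalabanUVNodesN08AlphaEq324RowCoreZero

end
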